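import Literature.Geometry.Riemannian.HeatKernelBasePointSmooth
import HarnessLib

/-!
# The heat propagation of a continuous datum is smooth for positive time and solves the heat
# equation (interior regularity by Hörmander's hypoellipticity theorem)

For a `C^∞` family `h(r)` of Riemannian metrics on a closed manifold `M` (modelled on `ℝᵐ`) the
tree's heat propagation of a CONTINUOUS datum `φ` at time `s`, `(x, t) ↦ (P_{s→t}φ)(x) =
heatValueC h s t x φ` (`HeatPropagation.lean`; the uniform limit of the smooth space-time
propagations of the smooth approximants `smoothApprox I φ n`), is so far only known to be
continuous on `M × [s, ∞)` (`continuousOn_heatValueC_spaceTime`). This file proves that it is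
`C^∞` on the OPEN slab `M × (s, ∞)` and solves `∂ₜ = Δ_{h(t)}` there, by the route the tree uses
for the heat kernel in the base point (`HeatKernelBasePointSmooth.lean`):

* `integral_heatValueC_mul_heatAdjoint_eq_zero` — the very weak space-time equation
  `∫ (P_{s→t}φ)(x) (−∂ₜ(ρζ) − ρ Δ_{h(t)}ζ)(x, t) d(V_{g₀} ⊗ dt) = 0` for smooth `ζ` compactly
  supported in `M × (s, ∞)` (the equation of the smooth propagations of the approximants,
  `integral_heatValue_mul_heatAdjoint_eq_zero`, passes to the uniform limit by dominated
  convergence);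
* **`contMDiffOn_and_deriv_heatValueC_spaceTime`** — `(x, t) ↦ (P_{s→t}φ)(x)` is `C^∞` on
  `M × (s, ∞)` and `∂ₜ (P_{s→t}φ)(x) = Δ_{h(t)} (P_{s→t}φ)(x)` there (Hörmander's interior
  regularity `exists_contMDiffOn_ae_eq_of_linearHeat_veryWeak`, uniqueness of continuous
  representatives `eqOn_of_ae_eq_of_continuousOn`, and the classical equation for smooth very
  weak solutions `linearHeat_classical_of_veryWeak_of_contMDiffOn`);
* `contMDiff_heatValueC_slice`, `heatValueC_eq_heatValue_heatValueC` — the slices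
  `x ↦ (P_{s→r}φ)(x)`, `r > s`, are smooth, and `P_{s→t} = P_{r→t} ∘ P_{s→r}` realises the
  propagation after time `r` as the propagation of a SMOOTH datum.

Purpose: the smoothing step of Colding's proof of the volume sphere theorem run through the heat
flow of a fixed metric (`Colding1996_volume_ghClose`; `CosDistHeatSubsolution.lean`).
Everything here is proved; no definitions, no named facts (D-0026).

## References

* L. Hörmander, *Hypoelliptic second order differential equations*, Acta Math. 119 (1967),
  Thm. 1.1. [Hormander1967]
* R. H. Bamler, *Entropy and heat kernel bounds on a Ricci flow background*, arXiv:2008.07093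
  (2020), §2 (the heat operator). [Bamler2020Entropy]
* F. Trèves, *Basic linear partial differential equations* (1975), §41. [Treves1975]
-/

noncomputable section

open Bundle Set Function Filter Manifold MeasureTheory Measure TopologicalSpace
open scoped Manifold ContDiff Topology ENNReal NNReal

namespace Literature.Geometry.Riemannian

open Lorentzian Lorentzian.PseudoRiemannianMetric

section ContinuousData

variable {m : ℕ} {H : Type*} [TopologicalSpace H]
  {I : ModelWithCorners ℝ (EuclideanSpace ℝ (Fin m)) H} [I.Boundaryless]
  {M : Type*} [TopologicalSpace M] [ChartedSpace H M] [IsManifold I ∞ M]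
  [T2Space M] [CompactSpace M] [SecondCountableTopology M] [MeasurableSpace M] [BorelSpace M]
  {h : ℝ → PseudoRiemannianMetric I ∞ (EuclideanSpace ℝ (Fin m)) (TangentSpace I : M → Type _)}
  {g₀ : PseudoRiemannianMetric I ∞ (EuclideanSpace ℝ (Fin m)) (TangentSpace I : M → Type _)}
  (hh : IsContMDiffFamilyOn ∞ h univ) (hR : ∀ r, (h r).IsRiemannian)

include hh hR in
/-- **Uniform bound for the propagations of the smooth approximants**: with `|φ| ≤ B`,
`|(P_{s→t} φₙ)(x)| ≤ B + 1` for the approximants `φₙ = smoothApprox I φ n` (`|φₙ − φ| < 1`, and the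
sup-norm contraction `abs_heatValue_sub_le` against the zero datum). [folklore] -/
theorem abs_heatValue_smoothApprox_le {φ : M → ℝ} (hφ : Continuous φ) {B : ℝ}
    (hB : ∀ y, |φ y| ≤ B) (n : ℕ) (s t : ℝ) (x : M) :
    |heatValue h s t x (smoothApprox I φ n)| ≤ B + 1 := by
  have h1 := abs_heatValue_sub_le hh hR (s := s) (t := t) x (contMDiff_smoothApprox hφ n)
    (contMDiff_const (c := (0 : ℝ))) (A := B + 1) fun y ↦ by
      rw [sub_zero]
      have h2 := (abs_smoothApprox_sub_lt (I := I) hφ n y).le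
      have h3 : 1 / ((n : ℝ) + 1) ≤ 1 := by
        rw [div_le_one (by positivity)]; linarith [n.cast_nonneg (α := ℝ)]
      calc |smoothApprox I φ n y| = |(smoothApprox I φ n y - φ y) + φ y| := by ring_nf
        _ ≤ |smoothApprox I φ n y - φ y| + |φ y| := abs_add_le _ _
        _ ≤ B + 1 := by linarith [hB y]
  rwa [heatValue_const hR, sub_zero] at h1

include hh hR in
/-- **The heat propagation of a continuous datum solves the heat equation very weakly in
space-time**: for a `C^∞` family `h` of Riemannian metrics on a closed manifold, a Riemannian
reference metric `g₀` with density ratio `ρ = dV_{h(t)}/dV_{g₀}`, a continuous datum `φ` at time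
`s` and every smooth `ζ` with compact support inside `M × (s, ∞)`,

  `∫ (P_{s→t}φ)(x) · (−∂ₜ(ρζ) − ρ Δ_{h(t)}ζ)(x, t) d(V_{g₀} ⊗ dt) = 0`

(the identity `integral_heatValue_mul_heatAdjoint_eq_zero` for the smooth approximants
`smoothApprox I φ n` passes to the limit `P φₙ → P φ` by dominated convergence: the bracket is
continuous with compact support and `|P φₙ| ≤ sup|φ| + 1`).
[cite: Treves1975, §41, (41.20)–(41.21)] [cite: Bamler2020Entropy, §2] -/
theorem integral_heatValueC_mul_heatAdjoint_eq_zero (hR₀ : g₀.IsRiemannian) {s : ℝ} {φ : M → ℝ}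
    (hφ : Continuous φ) {ζ : M × ℝ → ℝ} (hζ : ContMDiff (I.prod 𝓘(ℝ, ℝ)) 𝓘(ℝ, ℝ) ∞ ζ)
    (hζc : HasCompactSupport ζ) (hζT : tsupport ζ ⊆ univ ×ˢ Ioi s) :
    ∫ p, heatValueC h s p.2 p.1 φ *
        (-(deriv (fun t ↦ (h t).densityRatio g₀ p.1 * ζ (p.1, t)) p.2) -
          (h p.2).densityRatio g₀ p.1 * (h p.2).laplaceBeltrami (fun x ↦ ζ (x, p.2)) p.1)
      ∂g₀.riemVolume.prod (volume : Measure ℝ) = 0 := by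
  haveI : IsFiniteMeasure g₀.riemVolume := ⟨g₀.riemVolume_univ_lt_top⟩
  set ν : Measure (M × ℝ) := g₀.riemVolume.prod (volume : Measure ℝ) with hν
  -- the bracket `A = −∂ₜ(ρζ) − ρΔζ`: continuous, vanishing off `tsupport ζ`
  set A : M × ℝ → ℝ := fun p ↦ -(deriv (fun t ↦ (h t).densityRatio g₀ p.1 * ζ (p.1, t)) p.2) -
    (h p.2).densityRatio g₀ p.1 * (h p.2).laplaceBeltrami (fun x ↦ ζ (x, p.2)) p.1 with hA
  have hAc : Continuous A := by
    have h1 := (contMDiff_heatAdjoint (g₀ := g₀) (Q := fun (_ : ℝ) (_ : M) ↦ (0 : ℝ)) hh hR hR₀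
      contMDiff_const hζ).continuous
    exact h1.congr fun p ↦ by simp [hA]
  have hA0 : ∀ p ∉ tsupport ζ, A p = 0 := fun p hp ↦ by
    have h0 := heatAdjoint_eq_zero_of_notMem_tsupport (h := h) (g₀ := g₀)
      (Q := fun (_ : ℝ) (_ : M) ↦ (0 : ℝ)) hp
    simpa [hA] using h0
  have hAT : tsupport A ⊆ tsupport ζ :=
    closure_minimal (fun p hp ↦ by_contra fun h' ↦ hp (hA0 p h')) (isClosed_tsupport ζ)
  have hAsupp : HasCompactSupport A := HasCompactSupport.intro hζc fun p hp ↦ hA0 p (fun h' ↦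
    hp h')
  set O : Set (M × ℝ) := univ ×ˢ Ioi s with hO
  have hOo : IsOpen O := isOpen_univ.prod isOpen_Ioi
  -- the approximants and their limit
  set U : ℕ → M × ℝ → ℝ := fun n p ↦ heatValue h s p.2 p.1 (smoothApprox I φ n) with hU
  set Uinf : M × ℝ → ℝ := fun p ↦ heatValueC h s p.2 p.1 φ with hUinf
  have hUn : ∀ n, ∫ p, U n p * A p ∂ν = 0 := fun n ↦
    integral_heatValue_mul_heatAdjoint_eq_zero hh hR hR₀ (contMDiff_smoothApprox hφ n) hζ hζc hζT
  -- continuity of the integrands (on `O` the propagations are continuous, `A` lives inside `O`)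
  have hUc : ∀ n, Continuous fun p ↦ U n p * A p := fun n ↦
    continuous_mul_of_continuousOn_of_tsupport_subset hOo
      ((contMDiffOn_heatValue_spaceTime hh hR s (contMDiff_smoothApprox hφ n)).continuousOn.mono
        (prod_mono le_rfl Ioi_subset_Ici_self)) hAc (hAT.trans hζT)
  have hUinfc : Continuous fun p ↦ Uinf p * A p :=
    continuous_mul_of_continuousOn_of_tsupport_subset hOo
      ((continuousOn_heatValueC_spaceTime hh hR s hφ).mono (prod_mono le_rfl Ioi_subset_Ici_self))
      hAc (hAT.trans hζT)
  -- a uniform bound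
  obtain ⟨B, hB⟩ : ∃ B, ∀ y, |φ y| ≤ B := by
    obtain ⟨B, hB⟩ := isCompact_univ.exists_bound_of_continuousOn hφ.continuousOn
    exact ⟨B, fun y ↦ (Real.norm_eq_abs _).symm.le.trans (hB y (mem_univ _))⟩
  have hbound : ∀ n, ∀ᵐ p ∂ν, ‖U n p * A p‖ ≤ (B + 1) * |A p| := fun n ↦
    Eventually.of_forall fun p ↦ by
      rw [Real.norm_eq_abs, abs_mul]
      exact mul_le_mul_of_nonneg_right (abs_heatValue_smoothApprox_le hh hR hφ hB n s p.2 p.1)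
        (abs_nonneg _)
  have hbi : Integrable (fun p ↦ (B + 1) * |A p|) ν :=
    ((continuous_const.mul hAc.abs).integrable_of_hasCompactSupport (hAsupp.abs.mul_left))
  -- pointwise convergence
  have hlim_pt : ∀ᵐ p ∂ν, Tendsto (fun n ↦ U n p * A p) atTop (𝓝 (Uinf p * A p)) :=
    Eventually.of_forall fun p ↦
      (tendsto_heatValue_smoothApprox hh hR s p.2 p.1 hφ).mul_const (A p)
  have hlim := tendsto_integral_of_dominated_convergence (fun p ↦ (B + 1) * |A p|)
    (fun n ↦ (hUc n).aestronglyMeasurable) hbi hbound hlim_pt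
  have hzero : Tendsto (fun n : ℕ ↦ ∫ p, U n p * A p ∂ν) atTop (𝓝 0) := by
    simp only [hUn]
    exact tendsto_const_nhds
  have := tendsto_nhds_unique hlim hzero
  simpa only [hUinf, hA] using this

include hh hR in
/-- **The heat propagation of a continuous datum is `C^∞` for positive time and solves the heat
equation there** (interior regularity): for a `C^∞` family `h` of Riemannian metrics on a closed
manifold and a continuous `φ`, `(x, t) ↦ (P_{s→t}φ)(x)` is `C^∞` on `M × (s, ∞)` and
`∂ₜ (P_{s→t}φ)(x) = Δ_{h(t)} (P_{s→t}φ)(x)` there (the very weak equation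
`integral_heatValueC_mul_heatAdjoint_eq_zero`, Hörmander's interior regularity on the closed
manifold `exists_contMDiffOn_ae_eq_of_linearHeat_veryWeak`, uniqueness of continuous
representatives, and the classical equation for smooth very weak solutions
`linearHeat_classical_of_veryWeak_of_contMDiffOn`). [cite: Hormander1967, Thm 1.1]
[cite: Bamler2020Entropy, §2] -/
theorem contMDiffOn_and_deriv_heatValueC_spaceTime (s : ℝ) {φ : M → ℝ} (hφ : Continuous φ) :
    ContMDiffOn (I.prod 𝓘(ℝ, ℝ)) 𝓘(ℝ, ℝ) ∞ (fun p : M × ℝ ↦ heatValueC h s p.2 p.1 φ)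
        (univ ×ˢ Ioi s) ∧
      ∀ p ∈ (univ : Set M) ×ˢ Ioi s, deriv (fun t ↦ heatValueC h s t p.1 φ) p.2 =
        (h p.2).laplaceBeltrami (fun x ↦ heatValueC h s p.2 x φ) p.1 := by
  classical
  -- reference metric `g₀ = h s`
  set g₀ := h s with hg₀
  have hR₀ : g₀.IsRiemannian := hR s
  set μ₀ : Measure M := g₀.riemVolume with hμ₀
  haveI : IsFiniteMeasure μ₀ := ⟨by rw [hμ₀]; exact g₀.riemVolume_univ_lt_top⟩
  haveI : μ₀.IsOpenPosMeasure := by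
    rw [hμ₀, riemVolume_eq hR₀]; exact isOpenPosMeasure_riemannianMeasure _
  set ν : Measure (M × ℝ) := μ₀.prod (volume : Measure ℝ) with hν
  haveI : ν.IsOpenPosMeasure := prod.instIsOpenPosMeasure
  set O : Set (M × ℝ) := univ ×ˢ Ioi s with hO
  have hOo : IsOpen O := isOpen_univ.prod isOpen_Ioi
  have hOm : MeasurableSet O := hOo.measurableSet
  -- the function and its measurable extension by zero
  set u : M × ℝ → ℝ := fun p ↦ heatValueC h s p.2 p.1 φ with hu
  have huc : ContinuousOn u O :=
    (continuousOn_heatValueC_spaceTime hh hR s hφ).mono (prod_mono le_rfl Ioi_subset_Ici_self)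
  set ū : M × ℝ → ℝ := O.piecewise u 0 with hū
  have hūu : ∀ p ∈ O, ū p = u p := fun p hp ↦ Set.piecewise_eq_of_mem _ _ _ hp
  have hūm : Measurable ū := huc.measurable_piecewise continuousOn_const hOm
  have hūc : ContinuousOn ū O := huc.congr fun p hp ↦ hūu p hp
  have hūloc : LocallyIntegrableOn ū O ν := hūc.locallyIntegrableOn hOm
  -- the very weak equation (`Q = 0`, `G = 0`), for every `w` agreeing with `u` on `O`
  have hbr0 : ∀ {ζ : M × ℝ → ℝ} (p : M × ℝ), p ∉ tsupport ζ →
      -(deriv (fun t ↦ (h t).densityRatio g₀ p.1 * ζ (p.1, t)) p.2) -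
        (h p.2).densityRatio g₀ p.1 * (h p.2).laplaceBeltrami (fun x ↦ ζ (x, p.2)) p.1 = 0 := by
    intro ζ p hp
    have h0 := heatAdjoint_eq_zero_of_notMem_tsupport (h := h) (g₀ := g₀)
      (Q := fun (_ : ℝ) (_ : M) ↦ (0 : ℝ)) hp
    simpa using h0
  have hweak : ∀ (w : M × ℝ → ℝ), (∀ p ∈ O, w p = u p) →
      ∀ ζ : M × ℝ → ℝ, ContMDiff (I.prod 𝓘(ℝ, ℝ)) 𝓘(ℝ, ℝ) ∞ ζ → HasCompactSupport ζ →
      tsupport ζ ⊆ univ ×ˢ Ioi s →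
      ∫ p, w p * (-(deriv (fun t ↦ (h t).densityRatio g₀ p.1 * ζ (p.1, t)) p.2) -
          (h p.2).densityRatio g₀ p.1 * (h p.2).laplaceBeltrami (fun x ↦ ζ (x, p.2)) p.1 +
          (h p.2).densityRatio g₀ p.1 * (fun (_ : ℝ) (_ : M) ↦ (0 : ℝ)) p.2 p.1 * ζ p) ∂ν =
        ∫ p, (h p.2).densityRatio g₀ p.1 * (fun (_ : ℝ) (_ : M) ↦ (0 : ℝ)) p.2 p.1 * ζ p ∂ν := by
    intro w hw ζ hζ hζc hζT
    have e : ∀ p : M × ℝ, w p * (-(deriv (fun t ↦ (h t).densityRatio g₀ p.1 * ζ (p.1, t)) p.2) -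
        (h p.2).densityRatio g₀ p.1 * (h p.2).laplaceBeltrami (fun x ↦ ζ (x, p.2)) p.1 +
        (h p.2).densityRatio g₀ p.1 * (fun (_ : ℝ) (_ : M) ↦ (0 : ℝ)) p.2 p.1 * ζ p) =
        u p * (-(deriv (fun t ↦ (h t).densityRatio g₀ p.1 * ζ (p.1, t)) p.2) -
        (h p.2).densityRatio g₀ p.1 * (h p.2).laplaceBeltrami (fun x ↦ ζ (x, p.2)) p.1) := by
      intro p
      simp only [mul_zero, zero_mul, add_zero]
      by_cases hp : p ∈ tsupport ζ
      · rw [hw p (hζT hp)]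
      · rw [hbr0 p hp, mul_zero, mul_zero]
    rw [integral_congr_ae (Eventually.of_forall e),
      integral_heatValueC_mul_heatAdjoint_eq_zero hh hR hR₀ hφ hζ hζc hζT]
    simp
  -- interior regularity: a smooth representative `v`, equal to `u` on `O` by continuity
  obtain ⟨v, hv, hae⟩ := exists_contMDiffOn_ae_eq_of_linearHeat_veryWeak hh hR hR₀
    (Q := fun (_ : ℝ) (_ : M) ↦ (0 : ℝ)) (G := fun (_ : ℝ) (_ : M) ↦ (0 : ℝ))
    contMDiff_const contMDiff_const isOpen_Ioi hūm hūloc (hweak ū hūu)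
  have heq : EqOn ū v O := eqOn_of_ae_eq_of_continuousOn (μ := ν) hOo hūc hv.continuousOn hae
  have hus : ContMDiffOn (I.prod 𝓘(ℝ, ℝ)) 𝓘(ℝ, ℝ) ∞ u O :=
    hv.congr fun p hp ↦ (hūu p hp).symm.trans (heq hp)
  refine ⟨hus, fun p hp ↦ ?_⟩
  -- the classical equation for the smooth very weak solution `u`
  have hcl := linearHeat_classical_of_veryWeak_of_contMDiffOn hh hR hR₀
    (Q := fun (_ : ℝ) (_ : M) ↦ (0 : ℝ)) (G := fun (_ : ℝ) (_ : M) ↦ (0 : ℝ))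
    contMDiff_const contMDiff_const isOpen_Ioi hus (hweak u fun _ _ ↦ rfl) p hp
  simp only [zero_mul, add_zero, sub_eq_zero] at hcl
  simpa [hu] using hcl

include hh hR in
/-- **Slices of the heat propagation of a continuous datum are smooth**: for `s < r`,
`x ↦ (P_{s→r}φ)(x)` is `C^∞`. [cite: Hormander1967, Thm 1.1] -/
theorem contMDiff_heatValueC_slice {s r : ℝ} (hsr : s < r) {φ : M → ℝ} (hφ : Continuous φ) :
    ContMDiff I 𝓘(ℝ, ℝ) ∞ fun x ↦ heatValueC h s r x φ := by
  have h1 := (contMDiffOn_and_deriv_heatValueC_spaceTime hh hR s hφ).1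
  have h2 : ContMDiff I (I.prod 𝓘(ℝ, ℝ)) ∞ fun x : M ↦ ((x, r) : M × ℝ) :=
    contMDiff_id.prodMk contMDiff_const
  exact h1.comp_contMDiff h2 fun x ↦ ⟨mem_univ _, hsr⟩

include hh hR in
/-- **`P_{s→t} = P_{r→t} ∘ P_{s→r}` with a smooth intermediate datum**: for `s < r ≤ t` and
continuous `φ`, `(P_{s→t}φ)(x) = (P_{r→t}(P_{s→r}φ))(x)` where the right side is the propagation
`heatValue` of the SMOOTH datum `P_{s→r}φ` (`heatValueC_trans` and `heatValueC_eq_heatValue`).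
[cite: Bamler2020Entropy, §2] -/
theorem heatValueC_eq_heatValue_heatValueC {s r t : ℝ} (hsr : s < r) (hrt : r ≤ t) (x : M)
    {φ : M → ℝ} (hφ : Continuous φ) :
    heatValueC h s t x φ = heatValue h r t x (fun y ↦ heatValueC h s r y φ) := by
  rw [heatValueC_trans hh hR hsr.le hrt x hφ,
    heatValueC_eq_heatValue hh hR x (contMDiff_heatValueC_slice hh hR hsr hφ)]

end ContinuousData

end Literature.Geometry.Riemannian

end
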